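import Literature.Probability.Percolation.UniquenessInfiniteCluster
import HarnessLib

/-!
# Cut clusters: configuration-dependent hubs for the Burton–Keane counting argument

Topic `Literature/Probability/Percolation`. The cut-ball counting of Bollobás–Riordan,
*Percolation* (CUP 2006), Ch. 5, proof of Thm. 4 (pp. 107–109), as formalised in the tree
(`IsCutSet`, `cutBall`, `card_filter_cutBall_le`, `UniquenessInfiniteCluster.lean`), asks that
*all* edges of the ball `B_r(c)` be open — which is what insertion tolerance ("open every edge of
the ball") produces. For laws that are only **monotone finite-range images** of an insertion
tolerant law (block factors `F(ω)` of Bernoulli percolation, where opening all labels in a box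
opens all output edges of a smaller box but perturbs a boundary layer in an uncontrolled, merely
monotone, way) the ball is not fully open after the modification. The counting lemma of
`BurtonKeaneCombinatorics.lean` (`card_add_two_le_card_of_isHub`) however only needs the hub to be
*connected through open edges inside itself*. This file therefore replaces the ball by the
**hub** `hubIn ζ B c` — the open cluster of the centre `c` computed inside the finite set `B` — and
the cut-ball event by the **cut-cluster event** `cutClusterAt B c`: the hub has three open
neighbours lying in three distinct infinite open clusters of `ζ - hubIn ζ B c`.

Contents (definitions and their deterministic API):

* `hubIn`, `mem_hubIn_iff`, `hubIn_subset`, `self_mem_hubIn`, `mem_hubIn_of_adj`,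
  `mem_hubIn_of_reachable`, `hubIn_mono`, `hubIn_reachable` (the hub is connected inside itself);
* `cutClusterAt`, `isHub_of_mem_cutClusterAt` (a cut cluster is a hub of the open graph of a
  box relative to its inner boundary — Bollobás–Riordan 2006, p. 109, with balls replaced by
  hubs — so that the counting lemma `card_add_two_le_card_of_isHub` applies).

Transport along bijections, measurability, and the counting on `ℤ^d` (at most `|∂ⁱⁿΛ_{N+1}|`
cut clusters among `(2m+1)^d` disjoint translates) are in `CutClustersLattice.lean`; the
probabilistic use (uniqueness of the infinite cluster for laws with a "sandwich" insertion
tolerance, e.g. monotone finite-range factors of Bernoulli percolation) in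
`UniquenessSandwichTolerant.lean`.

## References

* B. Bollobás, O. Riordan, *Percolation*, Cambridge Univ. Press 2006, Ch. 5, Lemma 3 and proof of
  Thm. 4, pp. 106–109 of the held copy (printed pp. 120–124). [BollobasRiordan2006]
* R. M. Burton, M. Keane, *Density and uniqueness in percolation*, Comm. Math. Phys. 121 (1989)
  501–505. [BurtonKeane1989]

## Mathlib status

No percolation in Mathlib. Anchors: `SimpleGraph.Reachable`, `SimpleGraph.Walk.takeUntil`,
`Finset.filter`; tree: `IsHub`, `withinGraph`, `openClusterIn`, `openConnVia`, `percolatesVia`,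
`exists_adj_reachable_withinGraph_of_walk`, `innerBoundary`.
-/

noncomputable section

namespace Literature.Probability.Percolation

open MeasureTheory SimpleGraph Finset
open Percolation (shiftedBox mem_shiftedBox_iff shiftedBox_zero)
open scoped ENNReal

variable {V W : Type*}

/-! ### The hub: the open cluster of the centre computed inside a finite set -/

open Classical in
/-- The **hub** of the configuration `ζ` in the finite vertex set `B` with centre `c`: the
vertices of `B` joined to `c` by an open path all of whose vertices lie in `B` (the open cluster
of `c` of the configuration restricted to `B`; for `c ∉ B` it is empty). This is the
configuration-dependent replacement for the ball `B_r(c)` of Bollobás–Riordan 2006, Ch. 5,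
proof of Thm. 4. [folklore] -/
def hubIn (ζ : BondConfig V) (B : Finset V) (c : V) : Finset V :=
  B.filter fun v => ζ ∈ openConnVia (withinGraph ⊤ (↑B : Set V)) c v

/-- Membership in the hub: `v ∈ B` and `c ↔ v` by an open path inside `B`. [folklore] -/
theorem mem_hubIn_iff {ζ : BondConfig V} {B : Finset V} {c v : V} :
    v ∈ hubIn ζ B c ↔ v ∈ B ∧ (withinGraph (openGraph ζ) (↑B : Set V)).Reachable c v := by
  classical
  rw [hubIn, Finset.mem_filter, ← mem_openClusterIn_withinGraph_top_iff]
  rfl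

/-- Membership in the hub, in terms of the event `{c ↔ v via B}`. [folklore] -/
theorem mem_hubIn_iff' {ζ : BondConfig V} {B : Finset V} {c v : V} :
    v ∈ hubIn ζ B c ↔ v ∈ B ∧ ζ ∈ openConnVia (withinGraph ⊤ (↑B : Set V)) c v := by
  classical
  rw [hubIn, Finset.mem_filter]

/-- The hub lies inside `B`. [folklore] -/
theorem hubIn_subset (ζ : BondConfig V) (B : Finset V) (c : V) : hubIn ζ B c ⊆ B :=
  fun _ hv => (mem_hubIn_iff.1 hv).1

/-- The centre belongs to its hub (if it belongs to `B`). [folklore] -/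
theorem self_mem_hubIn {B : Finset V} {c : V} (hc : c ∈ B) (ζ : BondConfig V) : c ∈ hubIn ζ B c :=
  mem_hubIn_iff.2 ⟨hc, Reachable.refl _⟩

/-- A vertex of `B` joined inside `B` to a vertex of the hub belongs to the hub. [folklore] -/
theorem mem_hubIn_of_reachable {ζ : BondConfig V} {B : Finset V} {c k v : V} (hk : k ∈ hubIn ζ B c)
    (h : (withinGraph (openGraph ζ) (↑B : Set V)).Reachable k v) (hv : v ∈ B) : v ∈ hubIn ζ B c :=
  mem_hubIn_iff.2 ⟨hv, (mem_hubIn_iff.1 hk).2.trans h⟩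

/-- A vertex of `B` joined by an open edge to a vertex of the hub belongs to the hub. [folklore] -/
theorem mem_hubIn_of_adj {ζ : BondConfig V} {B : Finset V} {c k a : V} (hk : k ∈ hubIn ζ B c)
    (ha : a ∈ B) (hadj : (openGraph ζ).Adj k a) : a ∈ hubIn ζ B c :=
  mem_hubIn_of_reachable hk (Adj.reachable ⟨hadj, (mem_hubIn_iff.1 hk).1, ha⟩) ha

/-- The hub grows with the configuration. [folklore] -/
theorem hubIn_mono {η ζ : BondConfig V} (h : η ⊆ ζ) (B : Finset V) (c : V) : hubIn η B c ⊆ hubIn ζ B c := by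
  intro v hv
  rw [mem_hubIn_iff] at hv ⊢
  exact ⟨hv.1, hv.2.mono (withinGraph_mono_left (fromEdgeSet_mono h) _)⟩

/-- **The hub is connected through open edges inside itself**: every vertex of an open path
inside `B` starting at `c` is itself in the hub. [folklore] -/
theorem hubIn_reachable {ζ : BondConfig V} {B : Finset V} {c : V} (hc : c ∈ B) {x y : V}
    (hx : x ∈ hubIn ζ B c) (hy : y ∈ hubIn ζ B c) :
    (withinGraph (openGraph ζ) (↑(hubIn ζ B c) : Set V)).Reachable x y := by
  classical
  -- it suffices to join the centre to every vertex of the hub inside the hub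
  suffices key : ∀ v ∈ hubIn ζ B c, (withinGraph (openGraph ζ) (↑(hubIn ζ B c) : Set V)).Reachable c v from
    (key x hx).symm.trans (key y hy)
  intro v hv
  obtain ⟨-, ⟨p⟩⟩ := mem_hubIn_iff.1 hv
  have hsupp : ∀ u ∈ p.support, u ∈ (↑(hubIn ζ B c) : Set V) := by
    intro u hu
    rw [Finset.mem_coe, mem_hubIn_iff]
    exact ⟨support_subset_of_walk_withinGraph _ p hc u hu, ⟨p.takeUntil u hu⟩⟩
  exact reachable_withinGraph_of_support_subset (openGraph ζ) (p.mapLe (withinGraph_le _ _))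
    (by simpa only [Walk.support_mapLe_eq_support] using hsupp)

/-! ### The cut-cluster event -/

/-- The **cut-cluster event** at centre `c` in the finite set `B`: there are three vertices
outside the hub `K = hubIn ζ B c`, each joined to `K` by an open edge, lying in three distinct
infinite open clusters of `ζ - K` (open paths with steps avoiding `K`, the events
`openConnVia`/`percolatesVia` for the step graph `withinGraph ⊤ Kᶜ`). This is the `branches`
half of the tree's cut-set predicate `IsCutSet` (the bond version of the cut-ball event `T_r(x)`
of Bollobás–Riordan 2006, Ch. 5, p. 107) with the fully open ball replaced by the hub.
[cite: BollobasRiordan2006, Ch. 5, proof of Thm. 4 (p. 107, the event T_r(x))] -/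
def cutClusterAt (B : Finset V) (c : V) : Set (BondConfig V) :=
  {ζ | ∃ w : Fin 3 → V, (∀ i, w i ∉ hubIn ζ B c) ∧ (∀ i, ∃ k ∈ hubIn ζ B c, (openGraph ζ).Adj k (w i)) ∧
      (∀ i j, ζ ∈ openConnVia (withinGraph ⊤ (↑(hubIn ζ B c) : Set V)ᶜ) (w i) (w j) → i = j) ∧
      ∀ i, ζ ∈ percolatesVia (withinGraph ⊤ (↑(hubIn ζ B c) : Set V)ᶜ) (w i)}

/-- **A cut cluster is a hub** of the open graph of `Λ` relative to the inner boundary `∂ⁱⁿΛ`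
(Bollobás–Riordan 2006, Ch. 5, p. 109, for cut-balls; here for the configuration-dependent hub,
which is connected inside itself by `hubIn_reachable`). Hypotheses: `ζ ⊆ E(G)`, `c ∈ B`, and `Λ`
contains `B` together with all its neighbours. [cite: BollobasRiordan2006, Ch. 5, proof of Thm. 4 (p. 109)] -/
theorem isHub_of_mem_cutClusterAt [DecidableEq V] {G : SimpleGraph V} [G.LocallyFinite]
    {B Λ : Finset V} {c : V} {ζ : BondConfig V} (hcut : ζ ∈ cutClusterAt B c)
    (hζG : ζ ⊆ G.edgeSet) (hc : c ∈ B) (hBΛ : B ⊆ Λ) (hnb : ∀ k ∈ B, ∀ v, G.Adj k v → v ∈ Λ) :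
    IsHub (withinGraph (openGraph ζ) ↑Λ) (LatticeModels.innerBoundary G Λ) (hubIn ζ B c) := by
  obtain ⟨w, hwK, hwadj, hwdis, hwperc⟩ := hcut
  set K := hubIn ζ B c with hK
  have hKB : K ⊆ B := hubIn_subset ζ B c
  -- open edges are edges of `G`
  have hGadj : ∀ {a b : V}, (openGraph ζ).Adj a b → G.Adj a b := fun h => by
    rw [openGraph_adj] at h; exact hζG h.1
  have hwΛ : ∀ i, w i ∈ Λ := fun i => by
    obtain ⟨k, hk, hadj⟩ := hwadj i
    exact hnb k (hKB hk) _ (hGadj hadj)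
  refine ⟨⟨c, self_mem_hubIn hc ζ⟩, ?_, ?_, w, hwK, ?_, ?_, ?_⟩
  · -- `K` misses the inner boundary of `Λ`
    rw [Finset.disjoint_left]
    intro k hk hkL
    rw [LatticeModels.mem_innerBoundary_iff] at hkL
    obtain ⟨-, y, hy, hky⟩ := hkL
    exact hy (hnb k (hKB hk) y hky)
  · -- `K` is connected inside `K` in the open graph
    intro x hx y hy
    refine (hubIn_reachable hc hx hy).mono ?_
    rintro a b ⟨hab, ha, hb⟩
    exact ⟨⟨hab, hBΛ (hKB ha), hBΛ (hKB hb)⟩, ha, hb⟩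
  · intro i
    obtain ⟨k, hk, hadj⟩ := hwadj i
    exact ⟨k, hk, hadj, hBΛ (hKB hk), hwΛ i⟩
  · intro i j hij
    refine hwdis i j ?_
    change w j ∈ openClusterIn _ _ (w i)
    rw [mem_openClusterIn_withinGraph_top_iff]
    exact hij.mono (withinGraph_mono_left (withinGraph_le _ _) _)
  · intro i
    -- the infinite branch of `w i` in `ζ - K` leaves `Λ`; stop it at its first exit
    obtain ⟨u, hu, huΛ⟩ := (hwperc i).exists_notMem_finset Λ
    have hu' : (withinGraph (openGraph ζ) (↑K)ᶜ).Reachable (w i) u := by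
      rwa [mem_openClusterIn_withinGraph_top_iff] at hu
    obtain ⟨q⟩ := hu'
    obtain ⟨a, b, ha, hb, hab, -, hr⟩ := exists_adj_reachable_withinGraph_of_walk
      (withinGraph (openGraph ζ) (↑K)ᶜ) q (S := (↑Λ : Set V)) (hwΛ i)
      ⟨u, q.end_mem_support, huΛ⟩
    refine ⟨a, ?_, ?_⟩
    · rw [LatticeModels.mem_innerBoundary_iff]
      exact ⟨ha, b, hb, hGadj hab.1⟩
    · rw [withinGraph_withinGraph] at hr ⊢
      rwa [Set.inter_comm]

end Literature.Probability.Percolation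

end
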